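import Summits.BirchSwinnertonDyer.BirchSwinnertonDyer.Theorems.PrintCFramBottomClassIndexLawFiveLeBorelTypeTwoCebotarev
import Summits.BirchSwinnertonDyer.BirchSwinnertonDyer.Theorems.PrintCFramBottomClassIndexLawFiveLeBorelKolyvaginBlind
import Summits.BirchSwinnertonDyer.BirchSwinnertonDyer.Theorems.PrintCFramBottomClassIndexLawFiveLeBorelTypeTwoCongruences
import HarnessLib

/-!
# Route `PrintCFram`, crux C2 `BottomClassIndexLawFiveLe` (stmt-BirchSwinnertonDyer-20372), road II
# (`borel_heegner_squeeze` S2 `stub_kolyvaginUpper_borelCM`): **TYPE-TWO VISIBILITY** — the classes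
# that Gross's (3.2)-primes cannot see (`…BorelKolyvaginBlind`) ARE seen at Kolyvagin primes in the
# numerical sense of McCallum §4 / Kolyvagin 1990, as soon as some `z ∈ Γ_K` acts on `E[p^M]` as `−1`
# (cell `bsd-print-cfram`, width seat `bsd-line-cfram-p1-w5` g12; helper `--supports` 20372;
# 0 facts, 0 defs, 0 sorry)

HONEST FRAMING. Nothing about BSD is proved here, and nothing of the stub itself; this corrects ONE
reading on the crux's record. `…BorelKolyvaginBlind` proves that a depth-one eigenclass of sign
`−η_line` is locally trivial at every prime `ℓ` beyond a bound with `Frob(ℓ) = Frob(∞)` on `K(W[p^M])`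
(Gross's (3.2), recorded verbatim in `IsKolyvaginPrime` / `FrobEqFrobInfty`) — whence «Kolyvagin primes
are BLIND to the wrong-sign line», the defect `Δ(−η) = 1` of the order telescope (w2 g8), «one
`p`-step weak» (LEAD g14/g15). Kolyvagin's construction and McCallum §4 use of `ℓ` only `ℓ` inert,
`ℓ ∤ N d p`, `p^M ∣ ℓ + 1`, `p^M ∣ a_ℓ`. On the Borel CM class the Frobenius classes with characteristic
polynomial `X² − 1` on `W[p^M]` are of TWO types, `[c₀]` and `[c₀ z]` (`z` acting as `−1`; the line
character separates them), and the second type sees exactly what the first cannot: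
* (sibling `…BorelTypeTwoCongruences`: McCallum's congruences `p^M ∣ ℓ + 1`, `p^M ∣ a_ℓ` for an
  arithmetic Frobenius acting on `E(ℚ̄)[p^M]` as `−c₀`.)
* §4 **`exists_prime_gt_not_mem_torsionLocalKer_of_antiEigen_of_smul_eq_neg`** (any `E/ℚ`, image-free):
  for a `c_*`-eigenclass `x` (sign `ν`) all of whose values are `(−ν)`-eigen for the lift of complex
  conjugation — INVISIBLE to every (3.2)-prime — with a non-zero value, and `z ∈ Γ_K` acting on
  `E[p^M]` as `−1`: above every bound a prime `ℓ ∤ N d_K`, `ℓ ≠ p`, `(ℓ)` inert, `p^M ∣ ℓ + 1`,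
  `p^M ∣ a_ℓ` (good reduction), Frobenius `= −c₀` on `E(ℚ̄)[p^M]` and `= c₀` on `K`, and **`x_λ ≠ 0`**
  (sibling §1: `[x, (ρm)^τ(ρm)] = [x, ρ^τρ] + ([x, m] − ντ[x, m])` for `ρ` acting as `−1`, against
  `[x, m^τ m] = [x, m] + ντ[x, m]` at type one — the local eigenline of a global `ν`-class is SWAPPED).
* §5 `exists_prime_gt_not_mem_torsionLocalKer_not_frobEqFrobInfty_of_line_of_lineSign` — the same in
  the binders of `…BorelKolyvaginBlind` (`μ` with the sign rule of `√−p`, values on `ker μ`, complex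
  conjugation `= −ν` there); these primes satisfy `¬ FrobEqFrobInfty W K (p^M) ℓ`: (3.3) ⇏ (3.2) on
  the class, the difference being exactly the visibility of the blind line.

WHAT THIS DOES NOT DO. It does not produce `z` (on the class: `z` exists iff the line character takes
the value `−1` on `Γ_{K·K''}` — every proper quadratic twist `A(p)^{(e)}` with `K(√d_{K''}) ≠ K(√e)`;
never the untwisted `A(p)`; crux notes `Lines/eisenstein-resource-bdp-line-w5g12-type2.md`); it does
not re-key the descent's typed `Kol = IsKolyvaginPrime ∧ FrobEqFrobInfty` (the typing debt it names);
it does not close UPPER (at a type-two prime odd-depth classes of the RIGHT sign lose the `p` instead).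
THEOREMS ONLY; no definition, no named fact, no `sorry`. BSD is not proved by any of this; no summit
statement is proved by this seat. References: [McCallumLMS1991] §3 Prop. 3.1 with (2), (3); §4;
[GrossLMS1991] §3 (3.1)–(3.3), §9, Prop. 9.6; [KolyvaginEulerSystems1990] §1;
[SilvermanAEC2009] Prop. III.8.1, C.21 Remark 21.3.
-/

set_option autoImplicit false
-- `…BirchSwinnertonDyer.BirchSwinnertonDyer.Theorems…` is the problem's mandated namespace (D-0017).
set_option linter.dupNamespace false

noncomputable section

open scoped Classical Pointwise

namespace Summit.BirchSwinnertonDyer.BirchSwinnertonDyer.Theorems.PrintCFram.BorelTypeTwo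

open WeierstrassCurve NumberField IsDedekindDomain Field Literature.NumberTheory.EllipticCurves
  Literature.NumberTheory.GaloisRepresentations

universe u v

/-! ## §4 Type-two VISIBILITY of the classes that Gross's (3.2)-primes cannot see -/

section Visibility

variable (W : WeierstrassCurve ℚ) {K : Type u} [Field K] [NumberField K]

/-- `2 • P = 0 ⟹ P = 0` on `E[n]` for odd `n`. [folklore] -/
theorem eq_zero_of_two_zsmul_eq_zero {F : Type u} [Field F] (V : WeierstrassCurve F) {n : ℕ}
    (hn : Odd n) {P : geomTorsion V (n : ℤ)} (h2 : (2 : ℤ) • P = 0) : P = 0 := by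
  obtain ⟨u, hu⟩ := exists_two_mul_zsmul_eq_of_odd V hn
  rw [← hu P, mul_comm, mul_smul, h2, smul_zero]

omit [NumberField K] in
/-- **A `ρ` acting as `−1` that SEES a non-zero blind class.** Let `x` be a `σ_*`-eigenclass of sign
`ν` all of whose values are `(−ν)`-eigen for the involutive lift `τ` (invisible to type one) and
which has SOME non-zero value on `Γ_{K(E[n])}`, `n` odd; let `z ∈ Γ_K` act on `E[n]` as `−1`.
Then some `ρ ∈ {z, z·g}` (`g ∈ Γ_{K(E[n])}`) acts as `−1` with **`[x, ρ^τ ρ] ≠ 0`**: if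
`[x, z^τ z] = 0`, take `ρ = z g` with `[x, g] ≠ 0`, for which `[x, ρ^τρ] = [x, z^τ z] + 2[x, g] = 2[x, g]`.
[cite: McCallumLMS1991, §3 (2)] -/
theorem exists_smul_eq_neg_and_h1Eval_ne_zero {k : Type v} [Field k] [Algebra k K]
    (V : WeierstrassCurve k) {σ : K ≃ₐ[k] K} {τ : AlgebraicClosure K ≃+* AlgebraicClosure K}
    (hτ : IsLiftOfAut σ τ) (hinv : ∀ x, τ (τ x) = x) {n : ℕ} (hn : Odd n)
    {x : galH1Torsion (V.baseChange K) (n : ℤ)} {ν : ℤ} (hν : ν = 1 ∨ ν = -1)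
    (hx : conjAct V σ (n : ℤ) x = ν • x)
    (hvals : ∀ g ∈ torsionFixing (V.baseChange K) (n : ℤ),
      hτ.torsionMap V (n : ℤ) (h1Eval (V.baseChange K) (n : ℤ) x g) =
        -(ν • h1Eval (V.baseChange K) (n : ℤ) x g))
    (hx0 : ∃ g ∈ torsionFixing (V.baseChange K) (n : ℤ), h1Eval (V.baseChange K) (n : ℤ) x g ≠ 0)
    {z : absoluteGaloisGroup K} (hz : ∀ P : geomTorsion (V.baseChange K) (n : ℤ), z • P = -P) :
    ∃ ρ : absoluteGaloisGroup K, (∀ P : geomTorsion (V.baseChange K) (n : ℤ), ρ • P = -P) ∧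
      h1Eval (V.baseChange K) (n : ℤ) x (hτ.conjGalCMH ρ * ρ) ≠ 0 := by
  by_cases h0 : h1Eval (V.baseChange K) (n : ℤ) x (hτ.conjGalCMH z * z) = 0
  · obtain ⟨g, hg, hxg⟩ := hx0
    refine ⟨z * g, smul_eq_neg_mul_of_mem_torsionFixing V (n : ℤ) hz hg, fun h ↦ hxg ?_⟩
    rw [h1Eval_conjGalCMH_mul_mul_of_smul_eq_neg_of_antiEigen V hτ hinv (n : ℤ) hν hx hz hvals hg,
      h0, zero_add] at h
    exact eq_zero_of_two_zsmul_eq_zero (V.baseChange K) hn h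
  · exact ⟨z, hz, h0⟩

/-- **TYPE-TWO VISIBILITY (the correction of record).** `E = W/ℚ` elliptic, `K` imaginary quadratic
with complex conjugation `c` lifted along `c₀` (`τ = e c₀ e⁻¹`), `p` odd, `M ≥ 1`; `x ∈ H¹(K, E[p^M])`
a `c_*`-eigenclass of sign `ν` ALL of whose values are `(−ν)`-eigen for `τ` — exactly the classes
with `[x, g^τ g] = 0` for every `g ∈ Γ_{K(E[p^M])}` (`…BorelKolyvaginVisibility`,
`forall_h1Eval_conjGalCMH_mul_eq_zero_iff_antiEigen`), hence locally trivial at every (3.2)-prime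
(`Frob(ℓ) = Frob(∞)`); on the Borel CM class these are the depth-one classes of sign `−η_line`
(`…BorelKolyvaginVisibilityLeaf`, `…BorelKolyvaginBlind`) — with some non-zero value, and suppose
SOME `z ∈ Γ_K` acts on `E[p^M]` as `−1`. Then **above every bound there is a prime `ℓ`, `ℓ ∤ N·d_K`,
`ℓ ≠ p`, `(ℓ)` INERT in `K`, with McCallum's congruences `p^M ∣ ℓ + 1` and `p^M ∣ a_ℓ` (at the place
of `ℚ` above `ℓ`, if of good reduction), whose Frobenius acts on `E(ℚ̄)[p^M]` as MINUS a complex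
conjugation and on `K` as complex conjugation, and at whose place `λ` the class is NON-TRIVIAL:
`x_λ ≠ 0`.** So the descent's Čebotarev request «`x_λ ≠ 0` at a Kolyvagin prime above every bound»
is AVAILABLE for these classes once «Kolyvagin prime» is read numerically (McCallum §4 /
Kolyvagin 1990) instead of through Gross's (3.2). Proof: §1 gives `ρ` acting as `−1` with
`[x, ρ^τρ] ≠ 0`; §2 a prime with Frobenius `c₀·res(ρm)`, `m ∈ 𝒩_x`, and `x_λ = 0 ⟺ [x, (ρm)^τ(ρm)] = 0`;
by §1 `[x, (ρm)^τ(ρm)] = [x, ρ^τρ] + ([x, m] − ντ[x, m]) = [x, ρ^τρ]` as `[x, m] = 0`; §3 the congruences.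
[cite: McCallumLMS1991, §3 Prop. 3.1 with (2), (3); §4] [cite: GrossLMS1991, §3 (3.1)–(3.3)] -/
theorem exists_prime_gt_not_mem_torsionLocalKer_of_antiEigen_of_smul_eq_neg
    (hC : Literature.NumberTheory.Automorphic.chebotarev_artinRep) {N : ℕ} [NeZero N]
    [W.IsElliptic] (hK : IsImaginaryQuadratic K) {p : ℕ} (hp : p.Prime) (hp2 : p ≠ 2) {M : ℕ}
    (hM : 1 ≤ M) {c : K ≃ₐ[ℚ] K} {c₀ : absoluteGaloisGroup ℚ}
    (hc₀ : IsComplexConjugation (Rat.castHom ℝ) c₀)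
    (ht : IsLiftOfAut c (absGaloisTransport (K := ℚ) (L := K) c₀).toRingEquiv)
    {x : galH1Torsion (W.baseChange K) ((p ^ M : ℕ) : ℤ)} {ν : ℤ} (hν : ν = 1 ∨ ν = -1)
    (hx : conjAct W c ((p ^ M : ℕ) : ℤ) x = ν • x)
    (hvals : ∀ g ∈ torsionFixing (W.baseChange K) ((p ^ M : ℕ) : ℤ),
      ht.torsionMap W ((p ^ M : ℕ) : ℤ) (h1Eval (W.baseChange K) ((p ^ M : ℕ) : ℤ) x g) =
        -(ν • h1Eval (W.baseChange K) ((p ^ M : ℕ) : ℤ) x g))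
    (hx0 : ∃ g ∈ torsionFixing (W.baseChange K) ((p ^ M : ℕ) : ℤ),
      h1Eval (W.baseChange K) ((p ^ M : ℕ) : ℤ) x g ≠ 0)
    {z : absoluteGaloisGroup K} (hz : ∀ P : geomTorsion (W.baseChange K) ((p ^ M : ℕ) : ℤ), z • P = -P)
    (b : ℕ) :
    ∃ ℓ : ℕ, b < ℓ ∧ ℓ.Prime ∧ ¬ ℓ ∣ N ∧ ¬ ((ℓ : ℤ) ∣ NumberField.discr K) ∧ ℓ ≠ p ∧
      (Ideal.span {(ℓ : 𝓞 K)}).IsPrime ∧ p ^ M ∣ ℓ + 1 ∧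
      (∀ v : HeightOneSpectrum (𝓞 ℚ), (ℓ : 𝓞 ℚ) ∈ v.asIdeal → W.HasGoodReductionAt v →
        ((p : ℤ) ^ M) ∣ W.frobeniusTraceAt v) ∧
      (∃ (v : HeightOneSpectrum (𝓞 ℚ)) (𝔓₀ : Ideal (absIntegers (𝓞 ℚ) ℚ))
          (h : absoluteGaloisGroup ℚ),
        (ℓ : 𝓞 ℚ) ∈ v.asIdeal ∧ 𝔓₀ ∈ v.primesAbove ∧ IsArithFrobAt (𝓞 ℚ) h 𝔓₀ ∧
          (∀ P : geomTorsion W ((p ^ M : ℕ) : ℤ), h • P = -(c₀ • P)) ∧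
          ∀ (e : K →ₐ[ℚ] AlgebraicClosure ℚ) (y : K), h • e y = c₀ • e y) ∧
      ∀ w : HeightOneSpectrum (𝓞 K), (ℓ : 𝓞 K) ∈ w.asIdeal →
        x ∉ (W.baseChange K).torsionLocalKer (w.adicCompletion K) ((p ^ M : ℕ) : ℤ) := by
  haveI : Fact p.Prime := ⟨hp⟩
  haveI : Algebra.IsQuadraticExtension ℚ K := ⟨hK.1⟩
  have hinv : ∀ y, (absGaloisTransport (K := ℚ) (L := K) c₀).toRingEquiv
      ((absGaloisTransport (K := ℚ) (L := K) c₀).toRingEquiv y) = y := fun y ↦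
    RatClosure.absGaloisTransport_absGaloisTransport_of_sq_eq_one hc₀.sq_eq_one y
  have hodd : Odd (p ^ M) := (hp.odd_of_ne_two hp2).pow
  -- §1: a `ρ` acting as `−1` with `[x, ρ^τ ρ] ≠ 0`
  obtain ⟨ρ, hρ, hseen⟩ :=
    exists_smul_eq_neg_and_h1Eval_ne_zero W ht hinv hodd hν hx hvals hx0 hz
  have hρ2 := conjGalCMH_mul_mem_torsionFixing_of_smul_eq_neg W ht hinv _ hρ
  -- §2: the prime
  obtain ⟨ℓ, hbℓ, hℓ, hℓN, hℓD, hℓp, hprime, m, hm, ⟨v, 𝔓₀, hℓv, h𝔓₀, hfrob⟩, hloc⟩ :=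
    exists_prime_gt_of_galoisElement_of_conjGalCMH_mul_mem (N := N) hC hK hp hc₀ ht hinv
      (fun _ : Unit ↦ x) hρ2 b
  have hE : ∀ P : geomTorsion W ((p ^ M : ℕ) : ℤ),
      (c₀ * absGaloisRestrict ℚ K (ρ * m)) • P = -(c₀ • P) :=
    mul_absGaloisRestrict_smul_eq_neg W c₀ hρ hm.1
  refine ⟨ℓ, hbℓ, hℓ, hℓN, hℓD, hℓp, hprime,
    pow_dvd_add_one_of_smul_eq_neg W hp hM hℓ hℓp hℓv h𝔓₀ hfrob hc₀ hE,
    fun v' hv' hgood ↦ ?_, ⟨v, 𝔓₀, _, hℓv, h𝔓₀, hfrob, hE, fun e y ↦ ?_⟩, fun w hw hxw ↦ hseen ?_⟩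
  · have hvv : v' = v := HeightOneSpectrum.eq_of_natCast_mem_rat hℓ hv' hℓv
    subst hvv
    exact pow_dvd_frobeniusTraceAt_of_smul_eq_neg W hp hM hℓ hℓp hℓv h𝔓₀ hfrob hc₀ hE hgood
  · rw [mul_smul, absGaloisRestrict_smul_apply_eq (ρ * m) e y]
  · have h := (hloc x (AddSubgroup.subset_closure (Set.mem_range_self ())) w hw).mp hxw
    rwa [h1Eval_conjGalCMH_mul_mul_of_smul_eq_neg W ht hinv _ hν hx hρ hm.1, hm.2 (), map_zero,
      smul_zero, sub_zero, add_zero] at h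

end Visibility

/-! ## §5 On the Borel CM class: the blind line is seen by type-two primes, which therefore violate (3.2) -/

section Leaf

open Summit.BirchSwinnertonDyer.BirchSwinnertonDyer.Theorems.PrintCFram.BorelKolyvaginPairing

variable (W : WeierstrassCurve ℚ) (p : ℕ) [hp : Fact p.Prime] {K : Type} [Field K] [NumberField K]

/-- **THE DICHOTOMY BY FROBENIUS TYPE, in the binders of `…BorelKolyvaginBlind`.** Same data as
`exists_bound_forall_mem_torsionLocalKer_of_line_of_lineSign` there: `W/ℚ` elliptic with an
endomorphism `μ` of `W(ℚ̄)` obeying the sign rule of `√−p` (`hs`, `hcomm`, `hanti`); `K` imaginary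
quadratic with complex conjugation `c` (lifted along `c₀`); `x ∈ H¹(K, W[p^M])` a `c_*`-eigenclass of
sign `ν` with all values `[x, g]` on the line `ker μ`, on which complex conjugation acts by `−ν`
(`η_line = −ν`: the BLIND configuration — `x_λ = 0` at every (3.2)-prime `ℓ` beyond a bound); assume
`x` has a non-zero value and some `z ∈ Γ_K` acts on `W[p^M]` as `−1` (`p` odd, `M ≥ 1`). Then
**above every bound there is a prime `ℓ ∤ N·d_K`, `ℓ ≠ p`, `(ℓ)` prime in `𝓞 K`, with
`p^M ∣ ℓ + 1`, `p^M ∣ a_ℓ` (at a place of good reduction), `x_λ ≠ 0` at its place — and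
`¬ FrobEqFrobInfty W K (p^M) ℓ`:** the numerically-Kolyvagin primes that see the blind line are
exactly of the second Frobenius type, which Gross's (3.2) (hence the tree's `IsKolyvaginPrime` at
level `p^M`, and the descent's `Kol`) excludes. [cite: McCallumLMS1991, §3 (3), §4]
[cite: GrossLMS1991, §3 (3.2)–(3.3)] -/
theorem exists_prime_gt_not_mem_torsionLocalKer_not_frobEqFrobInfty_of_line_of_lineSign
    (hC : Literature.NumberTheory.Automorphic.chebotarev_artinRep) {N : ℕ} [NeZero N]
    [W.IsElliptic] (hK : IsImaginaryQuadratic K) (hp2 : p ≠ 2) {M : ℕ} (hM : 1 ≤ M)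
    {c : K ≃ₐ[ℚ] K} (hc : c ≠ 1) {c₀ : absoluteGaloisGroup ℚ}
    (hc₀ : IsComplexConjugation (Rat.castHom ℝ) c₀)
    (ht : IsLiftOfAut c (absGaloisTransport (K := ℚ) (L := K) c₀).toRingEquiv)
    {s : AlgebraicClosure ℚ} {μ : AddMonoid.End W.geomPoints}
    (hs : s ^ 2 = ((-(p : ℤ) : ℤ) : AlgebraicClosure ℚ))
    (hcomm : ∀ g : absoluteGaloisGroup ℚ, g • s = s → ∀ P, μ (g • P) = g • μ P)
    (hanti : ∀ g : absoluteGaloisGroup ℚ, g • s = -s → ∀ P, μ (g • P) = -(g • μ P))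
    {x : galH1Torsion (W.baseChange K) ((p ^ M : ℕ) : ℤ)} {ν : ℤ} (hν : ν = 1 ∨ ν = -1)
    (hx : conjAct W c ((p ^ M : ℕ) : ℤ) x = ν • x)
    (hline : ∀ g ∈ torsionFixing (W.baseChange K) ((p ^ M : ℕ) : ℤ),
      μ ((RatClosure.torsionEquiv (K := K) W ((p ^ M : ℕ) : ℤ)).symm
        (h1Eval (W.baseChange K) ((p ^ M : ℕ) : ℤ) x g) : W.geomTorsion ((p ^ M : ℕ) : ℤ)) = 0)
    (hη : ∀ P : W.geomPoints, μ P = 0 → c₀ • P = -(ν • P))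
    (hx0 : ∃ g ∈ torsionFixing (W.baseChange K) ((p ^ M : ℕ) : ℤ),
      h1Eval (W.baseChange K) ((p ^ M : ℕ) : ℤ) x g ≠ 0)
    {z : absoluteGaloisGroup K} (hz : ∀ P : geomTorsion (W.baseChange K) ((p ^ M : ℕ) : ℤ), z • P = -P)
    (b : ℕ) :
    ∃ ℓ : ℕ, b < ℓ ∧ ℓ.Prime ∧ ¬ ℓ ∣ N ∧ ¬ ((ℓ : ℤ) ∣ NumberField.discr K) ∧ ℓ ≠ p ∧
      (Ideal.span {(ℓ : 𝓞 K)}).IsPrime ∧ p ^ M ∣ ℓ + 1 ∧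
      (∀ v : HeightOneSpectrum (𝓞 ℚ), (ℓ : 𝓞 ℚ) ∈ v.asIdeal → W.HasGoodReductionAt v →
        ((p : ℤ) ^ M) ∣ W.frobeniusTraceAt v) ∧
      ¬ FrobEqFrobInfty W K (p ^ M) ℓ ∧
      ∀ w : HeightOneSpectrum (𝓞 K), (ℓ : 𝓞 K) ∈ w.asIdeal →
        x ∉ (W.baseChange K).torsionLocalKer (w.adicCompletion K) ((p ^ M : ℕ) : ℤ) := by
  have hpM0 : p ^ M ≠ 0 := pow_ne_zero M hp.out.ne_zero
  -- blindness at (3.2)-primes beyond `b₀`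
  obtain ⟨b₀, hb₀⟩ := exists_bound_forall_mem_torsionLocalKer_of_line_of_lineSign W p hK hc hs hcomm
    hanti hpM0 hν hx hline hc₀ hη
  -- the values are `(−ν)`-eigen for the lift `τ = e c₀ e⁻¹`
  have hvals : ∀ g ∈ torsionFixing (W.baseChange K) ((p ^ M : ℕ) : ℤ),
      ht.torsionMap W ((p ^ M : ℕ) : ℤ) (h1Eval (W.baseChange K) ((p ^ M : ℕ) : ℤ) x g) =
        -(ν • h1Eval (W.baseChange K) ((p ^ M : ℕ) : ℤ) x g) := fun g hg ↦ by
    rw [torsionMap_eq_lineSign_smul W ht (fun _ ↦ rfl) (η := -ν)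
      (fun P hP ↦ by rw [hη P hP, neg_smul]) _ _ (hline g hg), neg_smul]
  obtain ⟨ℓ, hbℓ, hℓ, hℓN, hℓD, hℓp, hprime, hdvd, htr, -, hloc⟩ :=
    exists_prime_gt_not_mem_torsionLocalKer_of_antiEigen_of_smul_eq_neg W (N := N) hC hK hp.out
      hp2 hM hc₀ ht hν hx hvals hx0 hz (max b b₀)
  refine ⟨ℓ, lt_of_le_of_lt (le_max_left _ _) hbℓ, hℓ, hℓN, hℓD, hℓp, hprime, hdvd, htr,
    fun hfrob ↦ ?_, hloc⟩
  -- the place `(ℓ)` of `K`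
  have hne : Ideal.span {(ℓ : 𝓞 K)} ≠ ⊥ := by
    rw [Ne, Ideal.span_singleton_eq_bot]; exact_mod_cast hℓ.ne_zero
  let w : HeightOneSpectrum (𝓞 K) := ⟨Ideal.span {(ℓ : 𝓞 K)}, hprime, hne⟩
  have hw : (ℓ : 𝓞 K) ∈ w.asIdeal := Ideal.mem_span_singleton_self _
  exact hloc w hw (hb₀ ℓ (lt_of_le_of_lt (le_max_right _ _) hbℓ) hℓ hℓD hfrob w hw)

end Leaf

end Summit.BirchSwinnertonDyer.BirchSwinnertonDyer.Theorems.PrintCFram.BorelTypeTwo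

end
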